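import Summits.RiemannHypothesis.RiemannHypothesis.Theorems.SignConeSignConeFarField

/-!
# Lemmas for the signed far-field majorant
(route `SignCone`, item stmt-RiemannHypothesis-16302 `SignConeOscillatory`; HELPER file, `--supports`)

Ingredients of `SignConeSignConeOscillatorySignedMajorant` (see that file for the statement and mechanism):
* `farField_numerics_margin` — the far-field constant of `SignConeFarField.stub_numerics` with the explicit margin
  `19/100`: `log 4π + γ − 1 + 19/100 ≤ 97/28·t₁ + 2.79(t₂ − t₁) + 4/25 + log 3 − 1/1000`;
* closed forms `∫_a^b dx/sinh x = P(b) − P(a)` (`P(y) = log(eʸ − 1) − log(eʸ + 1) = log tanh(y/2)`),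
  `∫_a^b (e^{x/2} + e^{-x/2}) dx = 4 sinh(b/2) − 4 sinh(a/2)`, `P(t₁) = log(12209/89041)` (`t₁ = 4 log(15/14)`);
* the two new pointwise minorants of Bombieri's integrand `h(A, σ, x) = σ(e^{-x/2} + e^{x/2}) − (e^{x/2}σ − 2A)/(2 sinh x)`:
  `regionOne_deficit` (`(A − D)·97/28 + D/sinh x ≤ h` on `(0, t₁]` when `σ ≤ 2(A − D)`; `h` is affine in `A` with slope
  `1/sinh x`) and `regionFour_signed` (`A/sinh x − 2D(e^{x/2} + e^{-x/2}) ≤ h` on `[log 2, ∞)` when `σ ≥ −2D`).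
-/

noncomputable section

-- `Summit.RiemannHypothesis.RiemannHypothesis.…` repeats a namespace component by design (D-0017 layout).
set_option linter.dupNamespace false

open scoped BigOperators ComplexConjugate
open Complex MeasureTheory Set Filter

namespace Summit.RiemannHypothesis.RiemannHypothesis.Theorems.SignCone

open Literature.NumberTheory.LFunctions
open Summit.RiemannHypothesis.RiemannHypothesis.Theorems.SignConeFarField

/-! ## Numerics: the far-field constant with an explicit margin -/

/-- `log(4π) = 2 log 2 + log 3 + log(π/3)`. [folklore] -/
private lemma log_four_pi_eq' :
    Real.log (4 * Real.pi) = 2 * Real.log 2 + Real.log 3 + Real.log (Real.pi / 3) := by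
  have h : (4 : ℝ) * Real.pi = 2 ^ 2 * 3 * (Real.pi / 3) := by ring
  rw [h, Real.log_mul (by positivity) (by positivity), Real.log_mul (by positivity) (by positivity),
    Real.log_pow]
  push_cast
  ring

/-- `log(4π) ≤ 2.5322`. [folklore] -/
private lemma log_four_pi_le' : Real.log (4 * Real.pi) ≤ 2.5322 := by
  rw [log_four_pi_eq']
  have h2 := Real.log_two_lt_d9
  have h3 := Real.log_three_lt_d9
  have hπ := Real.pi_lt_d4
  have hπ3 : Real.log (Real.pi / 3) ≤ Real.pi / 3 - 1 := Real.log_le_sub_one_of_pos (by positivity)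
  linarith

/-- **The far-field constant with margin `19/100`.**
`log 4π + γ − 1 + 19/100 ≤ 97/28·t₁ + 2.79·(t₂ − t₁) + 4/25 + log 3 − 1/1000` (`= 2.3039 ≥ 2.2982`), certified with
`log(15/14) ≥ 2/29`, `log(7/6) ≥ 2/13`, `log 3 > 1.0986122886`, `log(4π) ≤ 2.5322`, `γ < 0.57721567`. [folklore] -/
theorem farField_numerics_margin :
    Real.log (4 * Real.pi) + Real.eulerMascheroniConstant - 1 + 19 / 100 ≤
      97 / 28 * (4 * Real.log (15 / 14)) + 279 / 100 * (2 * Real.log (7 / 6) - 4 * Real.log (15 / 14)) +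
        4 / 25 + (Real.log 3 - 1 / 1000) := by
  have h4π := log_four_pi_le'
  have hγ := Literature.Analysis.SpecialFunctions.Real.eulerMascheroniConstant_lt_d8
  have hL1 : 2 / 29 ≤ Real.log (15 / 14) := by
    have h := Literature.Analysis.SpecialFunctions.Real.two_div_le_log_one_add_inv (a := 14) (by norm_num)
    norm_num at h
    exact h
  have hL2 : 2 / 13 ≤ Real.log (7 / 6) := by
    have h := Literature.Analysis.SpecialFunctions.Real.two_div_le_log_one_add_inv (a := 6) (by norm_num)
    norm_num at h
    exact h
  have h3 := Real.log_three_gt_d9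
  nlinarith

/-! ## Two closed-form integrals -/

/-- The primitive of `1/sinh`: for `x > 0`, `y ↦ log(eʸ − 1) − log(eʸ + 1)` has derivative `1/sinh x` at `x`. [folklore] -/
theorem hasDerivAt_log_tanh_half {x : ℝ} (hx : 0 < x) :
    HasDerivAt (fun y => Real.log (Real.exp y - 1) - Real.log (Real.exp y + 1)) (1 / Real.sinh x) x := by
  have h1 : 0 < Real.exp x - 1 := by
    have := Real.add_one_lt_exp hx.ne'
    linarith
  have h2 : 0 < Real.exp x + 1 := by positivity
  have hd : HasDerivAt (fun y => Real.log (Real.exp y - 1) - Real.log (Real.exp y + 1))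
      (Real.exp x / (Real.exp x - 1) - Real.exp x / (Real.exp x + 1)) x :=
    (((Real.hasDerivAt_exp x).sub_const 1).log h1.ne').sub
      (((Real.hasDerivAt_exp x).add_const 1).log h2.ne')
  convert hd using 1
  have hsinh : Real.sinh x ≠ 0 := (Real.sinh_pos_iff.2 hx).ne'
  rw [div_sub_div _ _ h1.ne' h2.ne', div_eq_div_iff hsinh (mul_ne_zero h1.ne' h2.ne'),
    Real.sinh_eq, Real.exp_neg]
  field_simp
  ring

/-- `∫_a^b dx/sinh x = P(b) − P(a)` for `0 < a ≤ b`, `P(y) = log(eʸ − 1) − log(eʸ + 1)` (`= log tanh(y/2)`). [folklore] -/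
theorem integral_one_div_sinh {a b : ℝ} (ha : 0 < a) (hab : a ≤ b) :
    ∫ x in a..b, 1 / Real.sinh x =
      (Real.log (Real.exp b - 1) - Real.log (Real.exp b + 1)) -
        (Real.log (Real.exp a - 1) - Real.log (Real.exp a + 1)) := by
  have hpos : ∀ x ∈ uIcc a b, 0 < x := by
    intro x hx
    rw [uIcc_of_le hab] at hx
    exact ha.trans_le hx.1
  have hderiv : ∀ x ∈ uIcc a b,
      HasDerivAt (fun y => Real.log (Real.exp y - 1) - Real.log (Real.exp y + 1)) (1 / Real.sinh x) x :=
    fun x hx => hasDerivAt_log_tanh_half (hpos x hx)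
  have hcont : ContinuousOn (fun x => 1 / Real.sinh x) (uIcc a b) :=
    ContinuousOn.div₀ continuousOn_const Real.continuous_sinh.continuousOn
      fun x hx => (Real.sinh_pos_iff.2 (hpos x hx)).ne'
  rw [intervalIntegral.integral_eq_sub_of_hasDerivAt hderiv hcont.intervalIntegrable]

/-- `∫_a^b (e^{x/2} + e^{-x/2}) dx = 4 sinh(b/2) − 4 sinh(a/2)`. [folklore] -/
theorem integral_exp_half_add_exp_neg_half (a b : ℝ) :
    ∫ x in a..b, (Real.exp (x / 2) + Real.exp (-(x / 2))) = 4 * Real.sinh (b / 2) - 4 * Real.sinh (a / 2) := by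
  have hderiv : ∀ x ∈ uIcc a b,
      HasDerivAt (fun y => 4 * Real.sinh (y / 2)) (Real.exp (x / 2) + Real.exp (-(x / 2))) x := by
    intro x _
    have h1 : HasDerivAt (fun y : ℝ => y / 2) (1 / 2) x := (hasDerivAt_id x).div_const 2
    have h2 : HasDerivAt (fun y : ℝ => Real.sinh (y / 2)) (Real.cosh (x / 2) * (1 / 2)) x :=
      HasDerivAt.sinh h1
    have h3 := h2.const_mul 4
    have e : 4 * (Real.cosh (x / 2) * (1 / 2)) = Real.exp (x / 2) + Real.exp (-(x / 2)) := by
      rw [Real.cosh_eq]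
      ring
    rw [e] at h3
    exact h3
  have hcont : Continuous fun x => Real.exp (x / 2) + Real.exp (-(x / 2)) := by fun_prop
  rw [intervalIntegral.integral_eq_sub_of_hasDerivAt hderiv (hcont.intervalIntegrable _ _)]

/-- `e^{4 log(15/14)} = (15/14)⁴`, so `P(t₁) = log(12209/89041)`. [folklore] -/
theorem primitive_at_t₁ :
    Real.log (Real.exp (4 * Real.log (15 / 14)) - 1) - Real.log (Real.exp (4 * Real.log (15 / 14)) + 1) =
      Real.log (12209 / 89041) := by
  have he : Real.exp (4 * Real.log (15 / 14)) = (15 / 14) ^ 4 := by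
    have e4 : (4 : ℝ) * Real.log (15 / 14) = Real.log ((15 / 14) ^ 4) := by
      rw [Real.log_pow]
      norm_num
    rw [e4, Real.exp_log (by positivity)]
  rw [he, ← Real.log_div (by norm_num) (by norm_num)]
  norm_num

/-! ## Pointwise minorants with deficit and with signed far field -/

/-- **Region `(ℓ, t₁]` with a deficit.** Bombieri's integrand `h(A, σ, x)` is affine in `A` with slope `1/sinh x`;
so if `σ ≤ 2(A − D)` (deficit `D`), the landed constant minorant at level `A − D` gives
`(A − D)·97/28 + D/sinh x ≤ h(A, σ, x)` on `(0, t₁]`. [folklore] -/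
theorem regionOne_deficit (A D σ x : ℝ) (hAD : 0 ≤ A - D) (hσ : σ ≤ 2 * (A - D)) (hx : 0 < x)
    (hx1 : x ≤ 4 * Real.log (15 / 14)) :
    (A - D) * (97 / 28) + D / Real.sinh x ≤
      σ * (Real.exp (-(x / 2)) + Real.exp (x / 2)) - (Real.exp (x / 2) * σ - 2 * A) / (2 * Real.sinh x) := by
  have h := stub_regionOneTwo.1 (A - D) σ x hAD hσ hx hx1
  have hs : Real.sinh x ≠ 0 := (Real.sinh_pos_iff.2 hx).ne'
  have e : σ * (Real.exp (-(x / 2)) + Real.exp (x / 2)) - (Real.exp (x / 2) * σ - 2 * A) / (2 * Real.sinh x) =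
      (σ * (Real.exp (-(x / 2)) + Real.exp (x / 2)) - (Real.exp (x / 2) * σ - 2 * (A - D)) / (2 * Real.sinh x)) +
        D / Real.sinh x := by
    field_simp
    ring
  rw [e]
  linarith

/-- **Far field with bounded negativity.** If `σ ≥ −2D` (`D ≥ 0`) and `x ≥ log 2` then
`A/sinh x − 2D(e^{x/2} + e^{-x/2}) ≤ h(A, σ, x)`: apply the landed far-field minorant to `σ + 2D ≥ 0` and note
`h(A, σ + 2D, x) − h(A, σ, x) = 2D(e^{-x/2} + e^{x/2}) − 2D e^{x/2}/(2 sinh x) ≤ 2D(e^{x/2} + e^{-x/2})`. [folklore] -/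
theorem regionFour_signed (A D σ x : ℝ) (hA : 0 ≤ A) (hD : 0 ≤ D) (hσ : -(2 * D) ≤ σ) (hx : Real.log 2 ≤ x) :
    A / Real.sinh x - 2 * D * (Real.exp (x / 2) + Real.exp (-(x / 2))) ≤
      σ * (Real.exp (-(x / 2)) + Real.exp (x / 2)) - (Real.exp (x / 2) * σ - 2 * A) / (2 * Real.sinh x) := by
  have h := stub_regionThreeFour.2 A (σ + 2 * D) x hA (by linarith) hx
  have hx0 : 0 < x := (Real.log_pos one_lt_two).trans_le hx
  have hs : 0 < Real.sinh x := Real.sinh_pos_iff.2 hx0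
  have hextra : 0 ≤ Real.exp (x / 2) * (2 * D) / (2 * Real.sinh x) := by positivity
  have e : (σ + 2 * D) * (Real.exp (-(x / 2)) + Real.exp (x / 2)) -
      (Real.exp (x / 2) * (σ + 2 * D) - 2 * A) / (2 * Real.sinh x) =
      (σ * (Real.exp (-(x / 2)) + Real.exp (x / 2)) - (Real.exp (x / 2) * σ - 2 * A) / (2 * Real.sinh x)) +
        2 * D * (Real.exp (x / 2) + Real.exp (-(x / 2))) - Real.exp (x / 2) * (2 * D) / (2 * Real.sinh x) := by
    field_simp
    ring
  rw [e] at h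
  linarith

/-- **Registered form of the margin numerics** (sub-goal `stub_signedMajorantNumerics` of item stmt-RiemannHypothesis-16302). [folklore] -/
theorem stub_signedMajorantNumerics : Real.log (4 * Real.pi) + Real.eulerMascheroniConstant - 1 + 19 / 100 ≤ 97 / 28 * (4 * Real.log (15 / 14)) + 279 / 100 * (2 * Real.log (7 / 6) - 4 * Real.log (15 / 14)) + 4 / 25 + (Real.log 3 - 1 / 1000) :=
  farField_numerics_margin

end Summit.RiemannHypothesis.RiemannHypothesis.Theorems.SignCone

end
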